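import Summits.NavierStokesRegularity.NavierStokesRegularity.Theorems.RellichScarScarRigidityPaintedLadderPressure
import Literature.Analysis.FluidPDE.TypeIAncientMild
import HarnessLib

/-!
# `ScarRigidity`, line `moment-conditioned-rellich` — stub `stub_paintedLadderHigher` (PL≥2): the painted ladder

Crux stmt-NavierStokesRegularity-11717 (route RellichScar): the registered stub `stub_paintedLadderHigher` of the skeleton
`Cruxes/ScarRigidity/Lines/moment_conditioned_rellich.lean`, assembled from parts 1–9
(`…PaintedLadderTimeStep`, `…Defect`, `…Representation`, `…KernelTaylor`, `…Multipole`, `…Harmonics`, `…MomentIdentity`,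
`…IteratedIBP`, `…Pressure`).

ONE RUNG (`farDecay_rung`): for two classical Navier–Stokes pairs on the open backward slab with the scale-invariant
packages and cubic flatness, flatness of order `N + 2` (`N ≥ 1`) together with the vanishing of the radiative moments of
degrees `2 ≤ ℓ' ≤ N` gives flatness of order `N + 3`: the painted pressure gradient of part 9,
`‖Dᵏ⁺¹(Q₁ − Q₂)(s,x)‖ ≤ P(√(−s))^N/‖x‖^{N+3+k}` on the parabolic exterior, is exactly the hypothesis of the
time-integration step of part 1.  For `N = 1` no moment condition enters (the only painted terms are of degrees `≤ 1`,
where the Hessian of the solid harmonic vanishes): **rung one `FarDecay 3 ⇒ FarDecay 4` is unconditional and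
pressure-painted**, so the ladder climbs from the cubic flatness of the scar itself and the registered statement follows
by induction on the rung — the apex-decay hypotheses of the registered signature are not used.
-/

noncomputable section

open Set Filter Function MeasureTheory Metric TopologicalSpace
open scoped Topology ContDiff
open Literature.Analysis.FluidPDE

set_option linter.dupNamespace false -- D-0017: `Summit.<S>.<S>.…` repeats the summit name by design

namespace Summit.NavierStokesRegularity.NavierStokesRegularity.Theorems.RellichScarScarRigidity

/-- Physical space (the notation of the skeleton `Cruxes/ScarRigidity/Lines/moment_conditioned_rellich.lean`). -/
local notation "ℝ³" => EuclideanSpace ℝ (Fin 3)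

/-- **One rung of the painted ladder.**  Under the scale-invariant packages and cubic flatness, flatness of order
`N + 2` (`N ≥ 1`) and the vanishing of the radiative moments of degrees `2 ≤ ℓ' ≤ N` give flatness of order `N + 3`
(part 9 feeds part 1). [folklore] -/
theorem farDecay_rung {V₁ V₂ : ℝ → ℝ³ → ℝ³} {Q₁ Q₂ : ℝ → ℝ³ → ℝ}
    (hcl₁ : IsClassicalNSSolutionOn (Iio (0 : ℝ)) 1 0 V₁ Q₁) (hcl₂ : IsClassicalNSSolutionOn (Iio (0 : ℝ)) 1 0 V₂ Q₂)
    (hB₁ : ScaleInvariantBounds V₁ Q₁) (hB₂ : ScaleInvariantBounds V₂ Q₂) (hF3 : FarDecay 3 V₁ V₂) {N : ℕ}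
    (hN : 1 ≤ N) (hFN : FarDecay (N + 2) V₁ V₂)
    (hmom : ∀ ℓ' : ℕ, 2 ≤ ℓ' → ℓ' ≤ N → RadiativeMomentsVanish ℓ' V₁ V₂) : FarDecay (N + 3) V₁ V₂ :=
  farDecay_succ_of_pressureGradient_bound hcl₁ hcl₂ hB₁ hB₂ hF3 N hFN fun k =>
    exists_pressureGradient_farField_bound hcl₁ hcl₂ hB₁ hB₂ hN hFN hmom k

/-- **The whole painted ladder from the cubic flatness**: `FarDecay 3` and the vanishing of the radiative moments of
degrees `2 ≤ ℓ' ≤ ℓ` give `FarDecay (ℓ + 3)`, for EVERY `ℓ` (induction on the rung; rung one is unconditional).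
[folklore] -/
theorem farDecay_of_moments {V₁ V₂ : ℝ → ℝ³ → ℝ³} {Q₁ Q₂ : ℝ → ℝ³ → ℝ}
    (hcl₁ : IsClassicalNSSolutionOn (Iio (0 : ℝ)) 1 0 V₁ Q₁) (hcl₂ : IsClassicalNSSolutionOn (Iio (0 : ℝ)) 1 0 V₂ Q₂)
    (hB₁ : ScaleInvariantBounds V₁ Q₁) (hB₂ : ScaleInvariantBounds V₂ Q₂) (hF3 : FarDecay 3 V₁ V₂) (ℓ : ℕ)
    (hmom : ∀ ℓ' : ℕ, 2 ≤ ℓ' → ℓ' ≤ ℓ → RadiativeMomentsVanish ℓ' V₁ V₂) : FarDecay (ℓ + 3) V₁ V₂ := by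
  induction ℓ with
  | zero => exact hF3
  | succ n ih =>
    have hFn : FarDecay (n + 1 + 2) V₁ V₂ := ih fun ℓ' h2 hle => hmom ℓ' h2 (Nat.le_succ_of_le hle)
    exact farDecay_rung hcl₁ hcl₂ hB₁ hB₂ hF3 (Nat.succ_pos n) hFn fun ℓ' h2 hle => hmom ℓ' h2 hle

/-- **PL≥2 — the painted ladder above the first rung (registered stub `stub_paintedLadderHigher` of line
`moment-conditioned-rellich`).**  Two classical Navier–Stokes pairs on the open slab with the apex bound at the same
constant, the scale-invariant package and cubic flatness whose radiative moments of degrees `2 ≤ ℓ' ≤ ℓ` vanish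
(`ℓ ≥ 2`) are flat of order `ℓ + 3`.  Mechanism: `∂ₜw = −∇π + (Δw − ∇·(V₁⊗V₁ − V₂⊗V₂))`,
`π = Q₁ − Q₂ = ℛᵢℛⱼ(V₁⊗V₁ − V₂⊗V₂)ᵢⱼ` (decaying gauges: every derivative of `π` is the Newtonian potential of the
corresponding derivative of `g = ∂ᵢ∂ⱼ(V₁⊗V₁ − V₂⊗V₂)ᵢⱼ`), the bracket is one order better by the previous rung, and the
far field of `∇π` is the multipole series whose coefficient at order `‖x‖^{−ℓ'−3}` is the radiative moment of degree
`ℓ'` (Stein, *Singular integrals* III §3). [folklore] -/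
theorem stub_paintedLadderHigher :
    ∀ (V₁ V₂ : ℝ → ℝ³ → ℝ³) (Q₁ Q₂ : ℝ → ℝ³ → ℝ) (C : ℝ) (ℓ : ℕ), 0 < C → 2 ≤ ℓ →
      IsClassicalNSSolutionOn (Iio (0 : ℝ)) 1 0 V₁ Q₁ → IsClassicalNSSolutionOn (Iio (0 : ℝ)) 1 0 V₂ Q₂ →
      HasTypeIDecay C V₁ → HasTypeIDecay C V₂ →
      ScaleInvariantBounds V₁ Q₁ → ScaleInvariantBounds V₂ Q₂ → FarDecay 3 V₁ V₂ →
      (∀ ℓ' : ℕ, 2 ≤ ℓ' → ℓ' ≤ ℓ → RadiativeMomentsVanish ℓ' V₁ V₂) →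
      FarDecay (ℓ + 3) V₁ V₂ :=
  fun _V₁ _V₂ _Q₁ _Q₂ _C ℓ _ _ hcl₁ hcl₂ _ _ hB₁ hB₂ hF3 hmom => farDecay_of_moments hcl₁ hcl₂ hB₁ hB₂ hF3 ℓ hmom

/-- **Rung one, pressure-painted and unconditional**: `FarDecay 3 ⇒ FarDecay 4` for two classical pairs with the
scale-invariant packages (no moment condition, no vorticity argument). [folklore] -/
theorem farDecay_four_of_three {V₁ V₂ : ℝ → ℝ³ → ℝ³} {Q₁ Q₂ : ℝ → ℝ³ → ℝ}
    (hcl₁ : IsClassicalNSSolutionOn (Iio (0 : ℝ)) 1 0 V₁ Q₁) (hcl₂ : IsClassicalNSSolutionOn (Iio (0 : ℝ)) 1 0 V₂ Q₂)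
    (hB₁ : ScaleInvariantBounds V₁ Q₁) (hB₂ : ScaleInvariantBounds V₂ Q₂) (hF3 : FarDecay 3 V₁ V₂) :
    FarDecay 4 V₁ V₂ :=
  farDecay_of_moments hcl₁ hcl₂ hB₁ hB₂ hF3 1 fun ℓ' h2 hle => absurd (h2.trans hle) (by norm_num)

end Summit.NavierStokesRegularity.NavierStokesRegularity.Theorems.RellichScarScarRigidity

end
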